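import Mathlib.Analysis.Asymptotics.Lemmas
import Literature.Computability.Complexity.PaulPippengerSzemerediTrotter1983Clocks
import HarnessLib

/-!
# The iterated logarithm `log*` and the PPST level `n · 2^{⌊log₂ log* n⌋}`: a linear-time binary clock

Literature / complexity toolkit, fourth brick of the inline formalization of the shell (§4) of
Paul–Pippenger–Szemerédi–Trotter 1983 (`PaulPippengerSzemerediTrotter1983.lean`, fact
`PaulEtAl1983_NTIME_not_subset_DTIME`). The assembly (`…Proofs.lean`) contradicts the
nondeterministic time hierarchy between the linear level and ONE superlinear level `g` at which
PPST's four-alternation speed-up `DTIME(t) ⊆ Σ₄TIME(t / log* t)` lands in `Σ₄TIME(n)`, i.e. a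
level with `g(n) / log* g(n) = O(n)`: PPST take `t(n) = n log* n`. The assembly needs of `g`:
`g ≥ id`, `n + 1 = o(g(n))`, and — for the linear-time validity test of pads
(`…Padding.lean`) — that `1ⁿ ↦ bin (g n)` be computable in LINEAR time. This file supplies such a
level and these three facts:

* `logStar n` — the iterated binary logarithm (`log* n = 0` for `n ≤ 1`,
  `log* n = log* ⌊log₂ n⌋ + 1` otherwise); `logStar_monotone`, `logStar_two_pow`,
  `tendsto_logStar_atTop` (unbounded, through the tower function), `logStar_le_size_sub_one`;
* `logStarLevel n = n · 2^{size (log* n) - 1}` — `n` times the largest power of two below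
  `log* n` (so `n ≤ logStarLevel n ≤ n · max 1 (log* n)`, `le_logStarLevel`, `logStarLevel_le`:
  it is PPST's level `n log* n` rounded DOWN, and `DTIME(logStarLevel) ⊆ DTIME(n log* n)`); the
  rounding makes its numeral `bin n` followed by `size (log* n) - 1` zeros, computable without any
  multiplication; `isLittleO_succ_logStarLevel : (n + 1) = o(logStarLevel n)`;
* `LogStarClock.prog` — a structured stack program (`Com`, over the bank `AReg`) computing
  `1ⁿ ↦ bin (logStarLevel n)`: the halving counter of `…Clocks.lean` (`LinClock.binLoop`) gives
  `bin n`; `log* n` is counted by iterating `w ↦ bin (|w| - 1)` (i.e. `m ↦ ⌊log₂ m⌋` on numerals,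
  each round linear in the current numeral, `O(log² n)` in total) under the fuel `|bin n|`; then
  the zeros are appended (`LogStarClock.runs_prog`, cost `≤ 24 n + 34 (size n)² + …`);
  **`timeComputable_logStarLevel`**: `TimeComputable unaryEncodeNat encodeNat logStarLevel (c n + c)`,
  whence `isTimeConstructible_logStarLevel`.

No named fact is introduced (definitions with bodies and theorems only).

## References

* W. J. Paul, N. Pippenger, E. Szemerédi, W. T. Trotter, *On determinism versus non-determinism
  and related problems*, FOCS 1983, 429–438 (the level `n log* n`) [PaulEtAl1983].
* R. Santhanam, *On separators, segregators and time versus space*, CCC 2001, §2, Prop. 2.4 and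
  Thm. 2.5 (`DTIME(t) ⊆ Σ₂-TIGU(n, t/log* t)`; the bound `n √(log* n)`) [Santhanam2001].
* S. Arora, B. Barak, *Computational Complexity: A Modern Approach*, CUP 2009, §1.3
  (time-constructible functions) [AroraBarakCC2009].
-/

namespace Literature.Computability.Complexity

open _root_.Computability Turing Filter Asymptotics

/-! ### The iterated logarithm -/

/-- **The iterated binary logarithm** `log* n`: the number of times `m ↦ ⌊log₂ m⌋` must be
applied to `n` to reach a value `≤ 1`. [cite: PaulEtAl1983, §1 (the function log*)] -/
def logStar (n : ℕ) : ℕ :=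
  if h : n ≤ 1 then 0 else logStar (Nat.log 2 n) + 1
termination_by n
decreasing_by exact Nat.log_lt_self 2 (by omega)

/-- `log* n = 0` for `n ≤ 1`. [folklore] -/
theorem logStar_of_le_one {n : ℕ} (h : n ≤ 1) : logStar n = 0 := by
  rw [logStar, dif_pos h]

/-- `log* n = log* ⌊log₂ n⌋ + 1` for `n ≥ 2`. [folklore] -/
theorem logStar_of_two_le {n : ℕ} (h : 2 ≤ n) : logStar n = logStar (Nat.log 2 n) + 1 := by
  rw [logStar, dif_neg (by omega)]

/-- `log* 0 = 0`. [folklore] -/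
@[simp] theorem logStar_zero : logStar 0 = 0 := logStar_of_le_one (by norm_num)

/-- `log* 1 = 0`. [folklore] -/
@[simp] theorem logStar_one : logStar 1 = 0 := logStar_of_le_one le_rfl

/-- `log*` is monotone. [folklore] -/
theorem logStar_monotone : Monotone logStar := by
  intro m n hmn
  induction n using Nat.strong_induction_on generalizing m with
  | _ n ih =>
    rcases Nat.lt_or_ge m 2 with hm | hm
    · rw [logStar_of_le_one (by omega)]; exact Nat.zero_le _
    · rw [logStar_of_two_le hm, logStar_of_two_le (show 2 ≤ n by omega)]
      exact Nat.succ_le_succ (ih _ (Nat.log_lt_self 2 (by omega)) (Nat.log_mono_right hmn))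

/-- `log* (2ᵐ) = log* m + 1` for `m ≥ 1`. [folklore] -/
theorem logStar_two_pow {m : ℕ} (hm : 1 ≤ m) : logStar (2 ^ m) = logStar m + 1 := by
  rw [logStar_of_two_le, Nat.log_pow one_lt_two]
  calc 2 = 2 ^ 1 := rfl
    _ ≤ 2 ^ m := Nat.pow_le_pow_right two_pos hm

/-- The tower function `2^2^…^2` (`k` twos). [folklore] -/
def tower : ℕ → ℕ
  | 0 => 1
  | k + 1 => 2 ^ tower k

/-- `1 ≤ tower k`. [folklore] -/
theorem one_le_tower : ∀ k, 1 ≤ tower k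
  | 0 => le_rfl
  | _ + 1 => Nat.one_le_two_pow

/-- `log* (tower k) = k`. [folklore] -/
theorem logStar_tower : ∀ k, logStar (tower k) = k
  | 0 => logStar_one
  | k + 1 => by rw [tower, logStar_two_pow (one_le_tower k), logStar_tower k]

/-- **`log*` is unbounded**: `logStar → ∞`. [folklore] -/
theorem tendsto_logStar_atTop : Tendsto logStar atTop atTop :=
  tendsto_atTop_atTop_of_monotone logStar_monotone fun k => ⟨tower k, (logStar_tower k).ge⟩

/-- `size m ≤ m` for every `m` (local copy of a two-line lemma also proved in unrelated files of
the tree, e.g. `CliqueRed.size_le_self`). [folklore] -/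
private theorem size_le_self (m : ℕ) : Nat.size m ≤ m :=
  Nat.size_le.2 m.lt_two_pow_self

/-- `size x = ⌊log₂ x⌋ + 1` for `x ≠ 0` (local copy of e.g. `LPO.size_eq_log_succ`, whose home
files are unrelated and heavy to import). [folklore] -/
private theorem size_eq_log_succ' {x : ℕ} (hx : x ≠ 0) : Nat.size x = Nat.log 2 x + 1 := by
  apply le_antisymm
  · exact Nat.size_le.2 (Nat.lt_pow_succ_log_self one_lt_two x)
  · have h1 : 2 ^ Nat.log 2 x ≤ x := Nat.pow_log_le_self 2 hx
    have h2 : x < 2 ^ Nat.size x := Nat.lt_size_self x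
    have : 2 ^ Nat.log 2 x < 2 ^ Nat.size x := lt_of_le_of_lt h1 h2
    exact (Nat.pow_lt_pow_iff_right (by norm_num)).1 this

/-- **`log* m ≤ size m - 1`** (so the fuel `bin n` suffices for the `log*` loop, with one round to
spare). [folklore] -/
theorem logStar_le_size_sub_one : ∀ m : ℕ, logStar m ≤ Nat.size m - 1 := by
  intro m
  induction m using Nat.strong_induction_on with
  | _ m ih =>
    rcases Nat.lt_or_ge m 2 with hm | hm
    · rw [logStar_of_le_one (by omega)]; exact Nat.zero_le _
    · rw [logStar_of_two_le hm, size_eq_log_succ' (by omega), Nat.add_sub_cancel]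
      have hl : 1 ≤ Nat.log 2 m := Nat.le_log_of_pow_le one_lt_two (by simpa using hm)
      have h1 := ih (Nat.log 2 m) (Nat.log_lt_self 2 (by omega))
      have h2 := size_le_self (Nat.log 2 m)
      omega

/-! ### The level `n · 2^{size (log* n) - 1}` -/

/-- **The PPST level, rounded to a shift**: `logStarLevel n = n · 2^{size (log* n) - 1}`, i.e. `n`
times the largest power of two not exceeding `log* n` (and `n` itself while `log* n = 0`). It lies
between `n (log* n + 1) / 2` and `n · max 1 (log* n)`, so it is PPST's level `n log* n` up to a
factor `2`, and its numeral is `bin n` preceded by `size (log* n) - 1` zeros.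
[cite: PaulEtAl1983, §4 (the level n log* n)] -/
def logStarLevel (n : ℕ) : ℕ :=
  n * 2 ^ (Nat.size (logStar n) - 1)

/-- `n ≤ logStarLevel n`. [folklore] -/
theorem le_logStarLevel (n : ℕ) : n ≤ logStarLevel n :=
  Nat.le_mul_of_pos_right n (Nat.two_pow_pos _)

/-- `2^{size s - 1} ≤ max 1 s`. [folklore] -/
theorem two_pow_size_sub_one_le (s : ℕ) : 2 ^ (Nat.size s - 1) ≤ max 1 s := by
  rcases Nat.eq_zero_or_pos s with rfl | hs
  · simp
  · have hsz : 0 < Nat.size s := Nat.size_pos.2 hs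
    have : 2 ^ (Nat.size s - 1) ≤ s := Nat.lt_size.1 (by omega)
    exact this.trans (le_max_right _ _)

/-- `s + 1 ≤ 2 · 2^{size s - 1}`. [folklore] -/
theorem succ_le_two_mul_two_pow_size_sub_one (s : ℕ) : s + 1 ≤ 2 * 2 ^ (Nat.size s - 1) := by
  rcases Nat.eq_zero_or_pos s with rfl | hs
  · simp
  · have hsz : 0 < Nat.size s := Nat.size_pos.2 hs
    have h := Nat.lt_size_self s
    have : 2 * 2 ^ (Nat.size s - 1) = 2 ^ Nat.size s := by
      rw [← pow_succ']; congr 1; omega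
    omega

/-- **`logStarLevel n ≤ n · max 1 (log* n)`**: the level is below PPST's `n log* n` (for
`log* n ≥ 1`), so `DTIME(logStarLevel) ⊆ DTIME(n log* n)` by monotonicity.
[cite: PaulEtAl1983, §4] -/
theorem logStarLevel_le (n : ℕ) : logStarLevel n ≤ n * max 1 (logStar n) :=
  Nat.mul_le_mul_left n (two_pow_size_sub_one_le _)

/-- `n (log* n + 1) ≤ 2 · logStarLevel n`. [folklore] -/
theorem mul_succ_logStar_le (n : ℕ) : n * (logStar n + 1) ≤ 2 * logStarLevel n := by
  unfold logStarLevel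
  have := succ_le_two_mul_two_pow_size_sub_one (logStar n)
  calc n * (logStar n + 1) ≤ n * (2 * 2 ^ (Nat.size (logStar n) - 1)) :=
        Nat.mul_le_mul_left n this
    _ = 2 * (n * 2 ^ (Nat.size (logStar n) - 1)) := by ring

/-- **The level is superlinear in Žák's sense**: `n + 1 = o(logStarLevel n)` (since
`logStarLevel n ≥ n (log* n + 1)/2` and `log* n → ∞`). [folklore] -/
theorem isLittleO_succ_logStarLevel :
    (fun n => ((n + 1 : ℕ) : ℝ)) =o[atTop] fun n => (logStarLevel n : ℝ) := by
  refine Asymptotics.isLittleO_iff.2 fun ε hε => ?_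
  -- eventually `log* n + 1 ≥ 4 / ε` and `n ≥ 1`
  obtain ⟨K, hK⟩ := exists_nat_gt (4 / ε)
  have hev : ∀ᶠ n in atTop, K ≤ logStar n := tendsto_atTop.1 tendsto_logStar_atTop K
  filter_upwards [hev, eventually_ge_atTop 1] with n hn hn1
  have hlev := mul_succ_logStar_le n
  -- real arithmetic
  have hK' : (4 : ℝ) / ε < (logStar n : ℝ) + 1 := by
    have : (K : ℝ) ≤ logStar n := by exact_mod_cast hn
    linarith
  have hpos : (0 : ℝ) < (logStar n : ℝ) + 1 := by positivity
  have h4 : (4 : ℝ) < ε * ((logStar n : ℝ) + 1) := by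
    have := (div_lt_iff₀ hε).1 (by simpa [div_div_eq_mul_div, mul_comm] using hK')
    linarith [this]
  have hlev' : (n : ℝ) * ((logStar n : ℝ) + 1) ≤ 2 * (logStarLevel n : ℝ) := by
    exact_mod_cast hlev
  have hn1' : (1 : ℝ) ≤ n := by exact_mod_cast hn1
  rw [Real.norm_natCast, Real.norm_natCast, Nat.cast_add, Nat.cast_one]
  -- `n + 1 ≤ 2 n ≤ (ε/2) · n (log* n + 1) ≤ ε · level`
  have hnn : (0 : ℝ) ≤ n := by positivity
  nlinarith [hlev', h4, hn1', hnn, mul_nonneg hnn hε.le]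

/-! ### Numerals shifted by zeros -/

/-- `bin (2ᵏ · n) = 0ᵏ ++ bin n` for `n ≠ 0`. [folklore] -/
theorem encodeNat_mul_two_pow {n : ℕ} (hn : n ≠ 0) :
    ∀ k : ℕ, encodeNat (n * 2 ^ k) = List.replicate k false ++ encodeNat n
  | 0 => by simp
  | k + 1 => by
    have e : n * 2 ^ (k + 1) = 2 * (n * 2 ^ k) := by ring
    have hne : 2 * (n * 2 ^ k) ≠ 0 := by positivity
    rw [e, encodeNat_eq_cons_div_two hne, Nat.mul_mod_right, Nat.mul_div_cancel_left _ two_pos,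
      encodeNat_mul_two_pow hn k, List.replicate_succ, List.cons_append]
    simp

/-- **The numeral of the level**: `bin (logStarLevel n) = 0^{size (log* n) - 1} ++ bin n`.
[folklore] -/
theorem encodeNat_logStarLevel (n : ℕ) :
    encodeNat (logStarLevel n) = List.replicate (Nat.size (logStar n) - 1) false ++ encodeNat n := by
  rcases Nat.eq_zero_or_pos n with rfl | hn
  · simp [logStarLevel, encodeNat, encodeNum]
  · exact encodeNat_mul_two_pow hn.ne' _

/-! ### The clock program -/

namespace LogStarClock

open Com AReg

/-- Triplicate `t` (read reversed) onto `y`, `u`, `g`. [folklore] -/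
def copy3 : Com AReg :=
  loop .t (push .y true ;; push .u true ;; push .g true) (push .y false ;; push .u false ;; push .g false)

/-- Effect of `copy3` (cost `≤ 5|tv| + 1`). [folklore] -/
theorem runs_copy3 : ∀ (tv xv yv zv sv uv fv gv : List Bool),
    Runs copy3 (file xv yv zv sv tv uv fv gv)
      (file xv (tv.reverse ++ yv) zv sv [] (tv.reverse ++ uv) fv (tv.reverse ++ gv)) (5 * tv.length + 1)
  | [], xv, yv, zv, sv, uv, fv, gv => (Runs.loop_nil _ _ (by simp)).of_eq (by simp) (by simp)
  | c :: tv, xv, yv, zv, sv, uv, fv, gv => by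
    have ih := runs_copy3 tv xv (c :: yv) zv sv (c :: uv) fv (c :: gv)
    have hbody : ∀ c : Bool, Runs (push AReg.y c ;; push AReg.u c ;; push AReg.g c)
        (file xv yv zv sv tv uv fv gv) (file xv (c :: yv) zv sv tv (c :: uv) fv (c :: gv))
        (1 + (1 + 1)) := fun c =>
      ((Runs.push AReg.y c _).seq ((Runs.push AReg.u c _).seq (Runs.push AReg.g c _))).of_eq
        (by simp) le_rfl
    cases c
    · refine (Runs.loop_false (w := tv) (by simp) (by simpa using hbody false) ih).of_eq ?_ ?_
      · simp
      · simp; omega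
    · refine (Runs.loop_true (w := tv) (by simp) (by simpa using hbody true) ih).of_eq ?_ ?_
      · simp
      · simp; omega

/-- Move `u` onto `x` as units. [folklore] -/
def unitsLoop : Com AReg := loop .u (push .x true) (push .x true)

/-- Effect of `unitsLoop` (cost `≤ 3|uv| + 1`): `x := 1^{|uv|} ++ x`, `u` emptied. [folklore] -/
theorem runs_unitsLoop : ∀ (uv xv yv zv sv tv fv gv : List Bool),
    Runs unitsLoop (file xv yv zv sv tv uv fv gv)
      (file (List.replicate uv.length true ++ xv) yv zv sv tv [] fv gv) (3 * uv.length + 1)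
  | [], xv, yv, zv, sv, tv, fv, gv => (Runs.loop_nil _ _ (by simp)).of_eq (by simp) (by simp)
  | c :: uv, xv, yv, zv, sv, tv, fv, gv => by
    have ih := runs_unitsLoop uv (true :: xv) yv zv sv tv fv gv
    have hbody : Runs (push AReg.x true) (file xv yv zv sv tv uv fv gv)
        (file (true :: xv) yv zv sv tv uv fv gv) 1 := (Runs.push AReg.x true _).of_eq (by simp) le_rfl
    have e : file (List.replicate uv.length true ++ true :: xv) yv zv sv tv [] fv gv =
        file (List.replicate (c :: uv).length true ++ xv) yv zv sv tv [] fv gv := by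
      simp [List.replicate_succ']
    cases c
    · exact (Runs.loop_false (w := uv) (by simp) (by simpa using hbody) ih).of_eq e
        (by simp only [List.length_cons]; omega)
    · exact (Runs.loop_true (w := uv) (by simp) (by simpa using hbody) ih).of_eq e
        (by simp only [List.length_cons]; omega)

/-- One effective round of the `log*` loop, entered after two symbols of the numeral `u` have been
popped: count the remaining symbols plus one in binary (`LinClock.binLoop`), put that numeral back
on `u`, and record the round on `z`. [folklore] -/
def stepA : Com AReg :=
  push .x true ;; unitsLoop ;; LinClock.binLoop ;; pour .t .u ;; push .z true

/-- Effect of `stepA` from `u = rest`, `x = t = s = f = ε`, `z = 1ᶜ` (cost `≤ 30|rest| + 32`):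
`u := bin (|rest| + 1)`, `z := 1^{c+1}`. [folklore] -/
theorem runs_stepA (rest yv gv : List Bool) (cnt : ℕ) :
    Runs stepA (file [] yv (List.replicate cnt true) [] [] rest [] gv)
      (file [] yv (List.replicate (cnt + 1) true) [] [] (encodeNat (rest.length + 1)) [] gv)
      (30 * rest.length + 32) := by
  have h1 : Runs (push AReg.x true) (file [] yv (List.replicate cnt true) [] [] rest [] gv)
      (file [true] yv (List.replicate cnt true) [] [] rest [] gv) 1 :=
    (Runs.push AReg.x true _).of_eq (by simp) le_rfl
  have h2 := runs_unitsLoop rest [true] yv (List.replicate cnt true) [] [] [] gv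
  have e2 : List.replicate rest.length true ++ [true] = List.replicate (rest.length + 1) true := by
    simp [List.replicate_succ']
  rw [e2] at h2
  have h3 := LinClock.runs_binLoop (rest.length + 1) [] yv (List.replicate cnt true) [] gv
  simp only [List.append_nil] at h3
  have h4 := runs_pour (a := AReg.t) (b := AReg.u) (by decide)
    (file [] yv (List.replicate cnt true) [] (encodeNat (rest.length + 1)).reverse [] [] gv)
  simp only [file_t, file_u, List.reverse_reverse, List.append_nil, List.length_reverse,
    update_file_t, update_file_u] at h4
  have h5 : Runs (push AReg.z true)
      (file [] yv (List.replicate cnt true) [] [] (encodeNat (rest.length + 1)) [] gv)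
      (file [] yv (List.replicate (cnt + 1) true) [] [] (encodeNat (rest.length + 1)) [] gv) 1 :=
    (Runs.push AReg.z true _).of_eq (by simp [List.replicate_succ]) le_rfl
  have hl : (encodeNat (rest.length + 1)).length ≤ rest.length + 1 := by
    rw [TM2Pass.length_encodeNat_eq_size]
    exact size_le_self _
  exact (h1.seq (h2.seq (h3.seq (h4.seq h5)))).mono (by omega)

/-- The body of the `log*` loop: two symbols of `u` ⇒ an effective round (`stepA`); one symbol ⇒
it is dropped (the value `1` has been reached); none ⇒ idle. [folklore] -/
def body : Com AReg :=
  pop .u (pop .u stepA stepA skip) (pop .u stepA stepA skip) skip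

/-- The `log*` loop under the fuel `g`. [folklore] -/
def lsLoop : Com AReg := loop .g body body

/-- Idle rounds: with `u = ε` the loop just burns its fuel (cost `≤ 4|fuel| + 1`). [folklore] -/
theorem runs_lsLoop_idle : ∀ (fuel yv zv : List Bool),
    Runs lsLoop (file [] yv zv [] [] [] [] fuel) (file [] yv zv [] [] [] [] []) (4 * fuel.length + 1)
  | [], yv, zv => (Runs.loop_nil _ _ (by simp)).of_eq (by simp) (by simp)
  | c :: fuel, yv, zv => by
    have ih := runs_lsLoop_idle fuel yv zv
    have hbody : Runs body (file [] yv zv [] [] [] [] fuel) (file [] yv zv [] [] [] [] fuel) 2 :=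
      Runs.pop_nil _ _ (by simp) (Runs.skip _)
    cases c
    · exact (Runs.loop_false (w := fuel) (by simp) (by simpa using hbody) ih).of_eq (by simp)
        (by simp; omega)
    · exact (Runs.loop_true (w := fuel) (by simp) (by simpa using hbody) ih).of_eq (by simp)
        (by simp; omega)

/-- The body on a numeral of a value `m ≥ 2` (`|w| = size m ≥ 2`): an effective round, after which
`u = bin ⌊log₂ m⌋` (cost `≤ 30 |w| + 34`). [folklore] -/
theorem runs_body_two_le {m : ℕ} (hm : 2 ≤ m) (w : List Bool) (hw : w.length = Nat.size m)
    (yv gv : List Bool) (cnt : ℕ) :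
    Runs body (file [] yv (List.replicate cnt true) [] [] w [] gv)
      (file [] yv (List.replicate (cnt + 1) true) [] [] (encodeNat (Nat.log 2 m)) [] gv)
      (30 * w.length + 34) := by
  have hsz : Nat.size m = Nat.log 2 m + 1 := size_eq_log_succ' (by omega)
  have hl : 1 ≤ Nat.log 2 m := Nat.le_log_of_pow_le one_lt_two (by simpa using hm)
  obtain ⟨b, b', rest, rfl⟩ : ∃ b b' rest, w = b :: b' :: rest := by
    match w, hw with
    | [], hw => simp at hw; omega
    | [b], hw => simp at hw; omega
    | b :: b' :: rest, _ => exact ⟨b, b', rest, rfl⟩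
  have hrest : rest.length + 1 = Nat.log 2 m := by simp at hw; omega
  have hA := runs_stepA rest yv gv cnt
  rw [hrest] at hA
  have hinner : ∀ b : Bool, Runs (pop AReg.u stepA stepA skip)
      (file [] yv (List.replicate cnt true) [] [] (b' :: rest) [] gv)
      (file [] yv (List.replicate (cnt + 1) true) [] [] (encodeNat (Nat.log 2 m)) [] gv)
      (30 * rest.length + 32 + 2) := fun b => by
    cases b'
    · exact Runs.pop_false _ _ (w := rest) (by simp) (by simpa using hA)
    · exact Runs.pop_true _ _ (w := rest) (by simp) (by simpa using hA)
  cases b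
  · exact (Runs.pop_false _ _ (w := b' :: rest) (by simp) (by simpa using hinner false)).mono
      (by simp; omega)
  · exact (Runs.pop_true _ _ (w := b' :: rest) (by simp) (by simpa using hinner true)).mono
      (by simp; omega)

/-- **Effect of the `log*` loop.** From `u = w` with `|w| = size m`, `|w| ≤ L`, a count `z = 1ᶜ`
and a fuel `g` of length `> log* m`: `z := 1^{c + log* m}`, `u` and `g` emptied (cost
`≤ |fuel| · (30 L + 36) + 1`). [folklore] -/
theorem runs_lsLoop : ∀ (fuel : List Bool) (m : ℕ) (w : List Bool) (cnt L : ℕ) (yv : List Bool),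
    w.length = Nat.size m → w.length ≤ L → logStar m + 1 ≤ fuel.length →
      Runs lsLoop (file [] yv (List.replicate cnt true) [] [] w [] fuel)
        (file [] yv (List.replicate (cnt + logStar m) true) [] [] [] [] [])
        (fuel.length * (30 * L + 36) + 1)
  | [], m, w, cnt, L, yv, hw, hL, hf => by simp at hf
  | c :: fuel, m, w, cnt, L, yv, hw, hL, hf => by
    rcases Nat.lt_or_ge m 2 with hm | hm
    · -- the value is `≤ 1`: drop the (at most one) symbol, then idle
      have hls : logStar m = 0 := logStar_of_le_one (by omega)
      have hwl : w.length ≤ 1 := by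
        rw [hw]; exact Nat.size_le.2 (by
          calc m < 2 := hm
            _ = 2 ^ 1 := rfl)
      have hidle := runs_lsLoop_idle fuel yv (List.replicate cnt true)
      have hbody : Runs body (file [] yv (List.replicate cnt true) [] [] w [] fuel)
          (file [] yv (List.replicate cnt true) [] [] [] [] fuel) 4 := by
        match w, hwl with
        | [], _ => exact (Runs.pop_nil _ _ (by simp) (Runs.skip _)).mono (by norm_num)
        | [b], _ =>
          cases b
          · exact Runs.pop_false _ _ (w := []) (by simp)
              (Runs.pop_nil _ _ (by simp) ((Runs.skip _).of_eq (by simp) (by norm_num)))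
          · exact Runs.pop_true _ _ (w := []) (by simp)
              (Runs.pop_nil _ _ (by simp) ((Runs.skip _).of_eq (by simp) (by norm_num)))
      have e : file [] yv (List.replicate cnt true) [] [] [] [] [] =
          file [] yv (List.replicate (cnt + logStar m) true) [] [] [] [] [] := by rw [hls]; rfl
      have hcost : 4 + 2 + (4 * fuel.length + 1) ≤ (c :: fuel).length * (30 * L + 36) + 1 := by
        simp only [List.length_cons]; nlinarith
      cases c
      · exact (Runs.loop_false (w := fuel) (by simp) (by simpa using hbody) hidle).of_eq e hcost
      · exact (Runs.loop_true (w := fuel) (by simp) (by simpa using hbody) hidle).of_eq e hcost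

    · -- an effective round
      have hbody := runs_body_two_le hm w hw yv fuel cnt
      have hsz' : (encodeNat (Nat.log 2 m)).length = Nat.size (Nat.log 2 m) :=
        TM2Pass.length_encodeNat_eq_size _
      have hL' : (encodeNat (Nat.log 2 m)).length ≤ L := by
        rw [hsz', size_eq_log_succ' (by
          have := Nat.le_log_of_pow_le one_lt_two (by simpa using hm : 2 ^ 1 ≤ m); omega)]
        rw [hw, size_eq_log_succ' (by omega)] at hL
        have := Nat.log_lt_self 2 (show Nat.log 2 m ≠ 0 by
          have := Nat.le_log_of_pow_le one_lt_two (by simpa using hm : 2 ^ 1 ≤ m); omega)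
        have := Nat.log_mono_right (b := 2) (Nat.log_lt_self 2 (show m ≠ 0 by omega)).le
        omega
      have hls : logStar m = logStar (Nat.log 2 m) + 1 := logStar_of_two_le hm
      have ih := runs_lsLoop fuel (Nat.log 2 m) (encodeNat (Nat.log 2 m)) (cnt + 1) L yv hsz' hL'
        (by simp at hf; omega)
      have e : file [] yv (List.replicate (cnt + 1 + logStar (Nat.log 2 m)) true) [] [] [] [] [] =
          file [] yv (List.replicate (cnt + logStar m) true) [] [] [] [] [] := by
        rw [hls, show cnt + 1 + logStar (Nat.log 2 m) = cnt + (logStar (Nat.log 2 m) + 1) by ring]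
      have hcost : 30 * w.length + 34 + 2 + (fuel.length * (30 * L + 36) + 1) ≤
          (c :: fuel).length * (30 * L + 36) + 1 := by
        simp only [List.length_cons]
        nlinarith [hL]
      cases c
      · exact (Runs.loop_false (w := fuel) (by simp) (by simpa using hbody) ih).of_eq e hcost
      · exact (Runs.loop_true (w := fuel) (by simp) (by simpa using hbody) ih).of_eq e hcost
/-- Push one zero on `y` per symbol of `t`. [folklore] -/
def zerosLoop : Com AReg := loop .t (push .y false) (push .y false)

/-- Effect of `zerosLoop` (cost `≤ 3|tv| + 1`): `y := 0^{|tv|} ++ y`, `t` emptied. [folklore] -/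
theorem runs_zerosLoop : ∀ (tv xv yv zv sv uv fv gv : List Bool),
    Runs zerosLoop (file xv yv zv sv tv uv fv gv)
      (file xv (List.replicate tv.length false ++ yv) zv sv [] uv fv gv) (3 * tv.length + 1)
  | [], xv, yv, zv, sv, uv, fv, gv => (Runs.loop_nil _ _ (by simp)).of_eq (by simp) (by simp)
  | c :: tv, xv, yv, zv, sv, uv, fv, gv => by
    have ih := runs_zerosLoop tv xv (false :: yv) zv sv uv fv gv
    have hbody : Runs (push AReg.y false) (file xv yv zv sv tv uv fv gv)
        (file xv (false :: yv) zv sv tv uv fv gv) 1 := (Runs.push AReg.y false _).of_eq (by simp) le_rfl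
    have e : file xv (List.replicate tv.length false ++ false :: yv) zv sv [] uv fv gv =
        file xv (List.replicate (c :: tv).length false ++ yv) zv sv [] uv fv gv := by
      simp [List.replicate_succ']
    cases c
    · exact (Runs.loop_false (w := tv) (by simp) (by simpa using hbody) ih).of_eq e
        (by simp only [List.length_cons]; omega)
    · exact (Runs.loop_true (w := tv) (by simp) (by simpa using hbody) ih).of_eq e
        (by simp only [List.length_cons]; omega)

/-- The shift stage: drop one symbol of `t`, then one zero on `y` per remaining symbol. [folklore] -/
def shift : Com AReg := pop .t zerosLoop zerosLoop skip

/-- Effect of `shift` (cost `≤ 3|tv| + 3`): `y := 0^{|tv| - 1} ++ y`, `t` emptied. [folklore] -/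
theorem runs_shift (tv yv : List Bool) :
    Runs shift (file [] yv [] [] tv [] [] [])
      (file [] (List.replicate (tv.length - 1) false ++ yv) [] [] [] [] [] []) (3 * tv.length + 3) := by
  cases tv with
  | nil => exact (Runs.pop_nil _ _ (by simp) ((Runs.skip _).of_eq (by simp) (by norm_num)))
  | cons c tv =>
    have h := runs_zerosLoop tv [] yv [] [] [] [] []
    cases c
    · exact (Runs.pop_false _ _ (w := tv) (by simp) (by simpa using h)).of_eq (by simp)
        (by simp only [List.length_cons]; omega)
    · exact (Runs.pop_true _ _ (w := tv) (by simp) (by simpa using h)).of_eq (by simp)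
        (by simp only [List.length_cons]; omega)

/-- **The clock program** `1ⁿ ↦ bin (logStarLevel n)` (input on `x`, output on `y`): `bin n`
(reversed on `t`, `LinClock.binLoop`), triplicated onto `y` (the output base), `u` (the iterated
numeral) and `g` (the fuel); the `log*` loop; clean `u`; count `log* n` in binary and append
`size (log* n) - 1` zeros below `bin n`. [folklore] -/
def prog : Com AReg :=
  LinClock.binLoop ;; copy3 ;; lsLoop ;; pour .z .x ;; LinClock.binLoop ;; shift

/-- `(size n)² ≤ 4 n + 4`. [folklore] -/
theorem size_sq_le (n : ℕ) : Nat.size n * Nat.size n ≤ 4 * n + 4 := by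
  have key : ∀ k : ℕ, k * k ≤ 2 ^ (k + 1) := by
    intro k
    induction k with
    | zero => norm_num
    | succ k ih =>
      rcases Nat.lt_or_ge k 3 with hk | hk
      · interval_cases k <;> norm_num
      · calc (k + 1) * (k + 1) = k * k + 2 * k + 1 := by ring
          _ ≤ k * k + k * k := by nlinarith
          _ ≤ 2 ^ (k + 1) + 2 ^ (k + 1) := Nat.add_le_add ih ih
          _ = 2 ^ (k + 1 + 1) := by rw [pow_succ]; ring
  rcases Nat.eq_zero_or_pos n with rfl | hn
  · simp
  · have hsz : 0 < Nat.size n := Nat.size_pos.2 hn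
    have h1 : 2 ^ (Nat.size n - 1) ≤ n := Nat.lt_size.1 (by omega)
    have h2 := key (Nat.size n)
    have : 2 ^ (Nat.size n + 1) = 4 * 2 ^ (Nat.size n - 1) := by
      rw [show Nat.size n + 1 = (Nat.size n - 1) + 2 by omega, pow_add]; ring
    omega

/-- **Effect of the clock program** (cost `≤ 24 n + 31 (size n)² + 75 size n + 10`, which is
`≤ 223 n + 210`): from `1ⁿ` on `x`, all else empty, to `bin (logStarLevel n)` on `y`, all else
empty. [cite: PaulEtAl1983, §4 (time-constructibility of the level)] -/
theorem runs_prog (n : ℕ) :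
    Runs prog (file (List.replicate n true) [] [] [] [] [] [] [])
      (file [] (encodeNat (logStarLevel n)) [] [] [] [] [] []) (223 * n + 210) := by
  rcases Nat.eq_zero_or_pos n with rfl | hn
  · -- empty input: every stage idles
    have h1 := LinClock.runs_binLoop 0 [] [] [] [] []
    have h2 := runs_copy3 [] [] [] [] [] [] [] []
    have h3 := runs_lsLoop_idle [] [] []
    have h4 := runs_pour (a := AReg.z) (b := AReg.x) (by decide) (file [] [] [] [] [] [] [] [])
    have h5 := LinClock.runs_binLoop 0 [] [] [] [] []
    have h6 := runs_shift [] []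
    simp only [List.replicate_zero, encodeNat, encodeNum, List.reverse_nil,
      List.append_nil, file_z, file_x, List.length_nil, update_file_z, update_file_x]
      at h1 h2 h3 h4 h5 h6 ⊢
    have e : logStarLevel 0 = 0 := by simp [logStarLevel]
    rw [e]
    exact (h1.seq (h2.seq (h3.seq (h4.seq (h5.seq h6))))).of_eq (by simp) (by norm_num)
  set L := Nat.size n with hLdef
  have hLpos : 0 < L := Nat.size_pos.2 hn
  have hlen : (encodeNat n).length = L := TM2Pass.length_encodeNat_eq_size n
  -- 1. `bin n`, reversed on `t`
  have h1 := LinClock.runs_binLoop n [] [] [] [] []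
  simp only [List.append_nil] at h1
  -- 2. triplicate
  have h2 := runs_copy3 (encodeNat n).reverse [] [] [] [] [] [] []
  simp only [List.reverse_reverse, List.append_nil, List.length_reverse, hlen] at h2
  -- 3. the `log*` loop
  have hfuel : logStar n + 1 ≤ (encodeNat n).length := by
    rw [hlen]; have := logStar_le_size_sub_one n; omega
  have h3 := runs_lsLoop (encodeNat n) n (encodeNat n) 0 L (encodeNat n) hlen hlen.le hfuel
  simp only [List.replicate_zero, Nat.zero_add, hlen] at h3
  -- 4. units of the count onto `x`
  have h4 := runs_pour (a := AReg.z) (b := AReg.x) (by decide)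
    (file [] (encodeNat n) (List.replicate (logStar n) true) [] [] [] [] [])
  simp only [file_z, file_x, List.reverse_replicate, List.append_nil, List.length_replicate,
    update_file_z, update_file_x] at h4
  -- 5. `bin (log* n)`, reversed on `t`
  have h5 := LinClock.runs_binLoop (logStar n) [] (encodeNat n) [] [] []
  simp only [List.append_nil] at h5
  -- 6. shift
  have h6 := runs_shift (encodeNat (logStar n)).reverse (encodeNat n)
  simp only [List.length_reverse, TM2Pass.length_encodeNat_eq_size] at h6
  rw [← encodeNat_logStarLevel] at h6
  have hls : logStar n ≤ L := by
    have := logStar_le_size_sub_one n; omega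
  have hszls : Nat.size (logStar n) ≤ L := (size_le_self _).trans hls
  have hsq := size_sq_le n
  have hLn : L ≤ n := size_le_self n
  refine (h1.seq (h2.seq (h3.seq (h4.seq (h5.seq h6))))).mono ?_
  rw [← hLdef] at hsq
  nlinarith [hsq, hLn, hls, hszls]

/-- **The compiled clock machine**: `1ⁿ ↦ bin (logStarLevel n)` within `223 n + 211` steps.
[cite: AroraBarakCC2009, §1.3] -/
theorem exists_machine : ∃ M : TM2ComputableAux Bool Bool, ∀ n : ℕ,
    M.OutputsWithin (List.replicate n true) (encodeNat (logStarLevel n)) (223 * n + 211) := by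
  refine ⟨(compile (prog.map (Fintype.equivFin AReg))).toAux (Fintype.equivFin AReg .x)
    (Fintype.equivFin AReg .y), fun n => ?_⟩
  have h := runs_prog n
  rw [← Com.init_x_eq_file, ← Com.init_y_eq_file] at h
  exact Com.outputsWithin_of_runs_equiv (Fintype.equivFin AReg) (Or.inl h)

end LogStarClock

/-! ### The level is linear-time computable in binary, hence time constructible -/

/-- **`1ⁿ ↦ bin (logStarLevel n)` in linear time** (`224 n + 224`).
[cite: AroraBarakCC2009, §1.3 (p. 16)] -/
theorem timeComputable_logStarLevel :
    TimeComputable unaryEncodeNat encodeNat logStarLevel fun n => 224 * n + 224 := by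
  obtain ⟨M, hM⟩ := LogStarClock.exists_machine
  refine ⟨M, fun n => ?_⟩
  have hl : (unaryEncodeNat n).length = n := unary_decode_encode_nat n
  dsimp only
  rw [hl, unaryEncodeNat_eq_replicate]
  exact (hM n).mono (by omega)

/-- **The level `n · 2^{size (log* n) - 1}` is time constructible.** [cite: AroraBarakCC2009, §1.3 (p. 16)] -/
theorem isTimeConstructible_logStarLevel : IsTimeConstructible logStarLevel :=
  ⟨le_logStarLevel, 224, timeComputable_logStarLevel.mono fun n =>
    Nat.add_le_add_right (Nat.mul_le_mul_left _ (le_logStarLevel n)) _⟩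

end Literature.Computability.Complexity
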